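import Summits.NavierStokesRegularity.FunctionalMining.NoGo.PalinstrophySupRate
import Literature.Analysis.FluidPDE.TorusBKMGradientLogBoundDG
import Summits.NavierStokesRegularity.FunctionalMining.PalinstrophyLadderProofs
import HarnessLib

/-!
# Functional mining: the log door for palinstrophy (K1-Q3) — static form of (a) and the typed (a″)

Search for candidate a priori estimates; no regularity claim.

Cell `pub-nsfunc` (host summit NavierStokesRegularity, topic `FunctionalMining`), dictionary seat,
STAGED for the prove / no-go seats (DICTIONARY.md §9 N10, §14 row K1-Q3, v1.6). v6 of the staging (v6 = v4 + the landed Literature fact `Torus.exists_gradSq_le_sq_bkm_posLog_ratio` (lit seat, p201667, Doering–Gibbon 1995 Thm 7.5 on `T³`, no mean condition, exactly the shape of `BKMLogGradientBound` at `d = Fin 3`): `exists_bkmLogGradientBound_fin3` is now a THEOREM, and the large-`C` log door at `Fin 3` is TWO prove targets away (`BKMImpliesDG` S, `DGImpliesLogBudget` M) with NO pending fact — `palinstrophyLogBudgetLargeC_fin3`; v5 (zero-mean detour) superseded); v4 of the staging: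
rebased on the tree's `NoGo/PalinstrophySupRate.lean` (p200052), which now OWNS the dynamic ⇒ static
reduction `PalinstrophyLogBudget.static` (filed there by the prove seat together with the no-go seat's
N6 statements) — this file only NAMES the static form (`PalinstrophyLogStatic`) and derives the no-go
door from the tree theorem; nothing of p200052 is duplicated. Contents:

* `PalinstrophyLogStatic C c` — the STATIC form of the typed log-door candidate
  `PalinstrophyLogBudget C c` (`Candidates.lean`, K1-Q3(a): `d𝒫/dt ≤ C‖ω‖_∞𝒫 log(e + c𝒫/ν²)`):
  `2N(v) − 2νD₃(v) ≤ C·M·𝒫(v)·log(e + c𝒫(v)/ν²)` for every smooth divergence-free `v` on `T³`,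
  every `ν > 0` and every pointwise vorticity bound `M` (`N = palinstrophyProduction`,
  `D₃ = palinstrophyDissipation`, `𝒫 = torusPalinstrophy` of `PalinstrophyLadder.lean`), the
  wrapper `palinstrophyLogStatic_of_logBudget` of the TREE reduction `PalinstrophyLogBudget.static`
  (p200052: dynamic ⇒ static at `t = 0` through the tree's smooth local existence
  `Torus.exists_classicalNS_smooth` and the `𝒫` balance `torusPalinstrophy_hasDerivWithinAt` — the
  same move as `QuadraticBudgetStatic.lean` for row C1), and the no-go criterion
  `not_palinstrophyLogBudget_of_static_violation`: ONE smooth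
  divergence-free field, one `ν` and one admissible `M` violating the static inequality refute
  `PalinstrophyLogBudget C c`. This is the door the no-go seat's planted two-scale witness
  (DICTIONARY N10: bounded-vorticity corner vortex × high-frequency packet; predicted range
  `C < 8/(9π)`, every `c > 0`; [ours], heuristic) has to go through.
* `PalinstrophyLogBudgetKT C c` — the dictionary's RE-TYPED log door (a″) [ours; conjecture as
  typed, expected PROVABLE]: `d𝒫/dt + νD₃ ≤ C·M·𝒫·(1 + log⁺(c𝒫/(νM)))` along classical solutions,
  for every pointwise vorticity bound `M`. Expected proof (prove seat, once the lit seat lands the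
  fact): the tree's `Torus.abs_integral_inner_convect_bilaplacian_le` (`N ≤ 3‖∇u‖_∞𝒫`, DG95
  (6.2.25) `N = 2`) + the homogeneous Brezis–Gallouët–Wainger / Kozono–Taniuchi inequality on `T³`
  (`‖∇u‖_∞ ≤ C_B‖ω‖_∞(1 + log⁺(√D₃/‖ω‖_∞))`, a Literature NAMED FACT to be filed with its citation —
  NOT in the tree yet) + the real inequality `sup_D [A log(D/M²) − νD] = A log(A/(eνM²))`. Its log
  argument `𝒫/(νM)` has Navier–Stokes degree `0` like (a)'s `𝒫/ν²` but is not bounded by a power of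
  it; nevertheless (a″) FORCES (a) for large `C` once `D₃ ≥ 𝒫²/M²` is used (`KTImpliesLogBudget` below).

* `KTImpliesLogBudget` / `palinstrophyLogConst` / `PalinstrophyLogBudgetLargeC` — the THRESHOLD STRUCTURE of
  K1-Q3 [ours; sketch]: (a″) together with the tree's interpolation `𝒫² ≤ (2ℰ)D₃` and `2ℰ ≤ M²`
  forces (a) for every `C ≥ C⋆(C₁, c₁, c)` (explicit), by a two-case real-analysis argument (target
  for the prove seat, no new fact needed); with the expected small-`C` witnesses, (a) is then a
  threshold law with a sharp-constant question — it is NOT mis-typed (this supersedes the first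
  reading in DICTIONARY N10 (ii)).

* `PalinstrophyLogBudget.mono` (monotone in `C`), and the HELD-FACT CHAIN: `BKMLogGradientBound c` = the
  SHAPE (majorant form, `N = 3`, `r = 2`, unit box) of the periodic-box Beale–Kato–Majda inequality
  of Doering–Gibbon 1995, Thm 7.5 p. 125 — a hypothesis here, to be landed by the lit seat as a cited
  Literature fact; the variant (a‴) `PalinstrophyLogBudgetDG C c` (`d𝒫/dt + νD₃ ≤ CM𝒫(1 + log⁺(cM/ν))`);
  the targets `BKMImpliesDG` (S-sized) and `DGImpliesLogBudget` ((a‴) ⇒ (a) for all large `C`, M-sized,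
  tree material only) and the assembly `palinstrophyLogBudgetLargeC_of_BKM`. So the positive half of
  the K1-Q3 threshold law needs exactly ONE held, published inequality.

No Literature fact is introduced here; nothing in this file is a cited result. [ours]
-/

noncomputable section

open Set MeasureTheory
open scoped InnerProductSpace RealInnerProductSpace

namespace Summit.NavierStokesRegularity.FunctionalMining

open Literature.Analysis.FunctionSpaces Literature.Analysis.FluidPDE

variable {d : Type*} [Fintype d] [DecidableEq d]

/-! ## K1-Q3(a): the static form and the dynamic ⇒ static reduction -/

/-- **Static form of the log door (a)** [ours]: for every `ν > 0`, every smooth divergence-free `v`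
on `T³` and every `M ≥ 0` with `|ω_v|² ≤ M²` pointwise,
`2N(v) − 2νD₃(v) ≤ C·M·𝒫(v)·log(e + c𝒫(v)/ν²)`. Search for candidate a priori estimates; no
regularity claim. -/
def PalinstrophyLogStatic (C c : ℝ) : Prop :=
  Fintype.card d = 3 → ∀ {ν : ℝ}, 0 < ν → ∀ v : UnitAddTorus d → EuclideanSpace ℝ d,
    Torus.IsSmooth v → Torus.IsDivFree v → ∀ M : ℝ, 0 ≤ M → (∀ x, torusVorticitySqAt v x ≤ M ^ 2) →
      2 * palinstrophyProduction v - 2 * ν * palinstrophyDissipation v ≤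
        C * M * torusPalinstrophy v * Real.log (Real.exp 1 + c * torusPalinstrophy v / ν ^ 2)

/-- **Dynamic ⇒ static for the log door (a)**, packaged: `PalinstrophyLogBudget C c` implies
`PalinstrophyLogStatic C c`. This is the TREE theorem `PalinstrophyLogBudget.static`
(`NoGo/PalinstrophySupRate.lean`, p200052: run the smooth local solution from the datum and evaluate
the budget at `t = 0`, where the `𝒫` balance identifies the rate as `2N − 2νD₃`), re-stated with the
named static form as conclusion. [folklore; wrapper of a tree theorem] -/
theorem palinstrophyLogStatic_of_logBudget {C c : ℝ} (h : PalinstrophyLogBudget (d := d) C c) :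
    PalinstrophyLogStatic (d := d) C c :=
  fun hd _ν hν _v hv hdiv _M hM hMx => h.static hd hν hv hdiv hM hMx

/-- **No-go criterion for the log door (a)** [ours]: one smooth divergence-free field `v` on `T³`,
one `ν > 0` and one admissible vorticity bound `M` with
`C·M·𝒫(v)·log(e + c𝒫(v)/ν²) < 2N(v) − 2νD₃(v)` refute `PalinstrophyLogBudget C c`. This is the
door for the planted two-scale witness of DICTIONARY N10 (threshold kill for small `C`; the
UNLOGGED row is killed for every `C` by N6, `PalinstrophySupRateFails`, and implies the logged one by
the tree's `palinstrophyLogBudget_of_rateSupBound`). Search for candidate a priori estimates; no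
regularity claim. [ours] -/
theorem not_palinstrophyLogBudget_of_static_violation (hd : Fintype.card d = 3) {C c ν : ℝ}
    (hν : 0 < ν) {v : UnitAddTorus d → EuclideanSpace ℝ d} (hv : Torus.IsSmooth v)
    (hdiv : Torus.IsDivFree v) {M : ℝ} (hM : 0 ≤ M) (hMx : ∀ x, torusVorticitySqAt v x ≤ M ^ 2)
    (hviol : C * M * torusPalinstrophy v * Real.log (Real.exp 1 + c * torusPalinstrophy v / ν ^ 2) <
      2 * palinstrophyProduction v - 2 * ν * palinstrophyDissipation v) :
    ¬ PalinstrophyLogBudget (d := d) C c := fun h =>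
  (hviol.trans_le (palinstrophyLogStatic_of_logBudget h hd hν v hv hdiv M hM hMx)).false

/-! ## K1-Q3(a″): the re-typed log door -/

/-- **K1-Q3(a″) — the re-typed log door for palinstrophy** [ours; conjecture as typed, expected
provable from a Brezis–Gallouët–Wainger fact + `Torus.abs_integral_inner_convect_bilaplacian_le`]:
along every classical solution of unforced Navier–Stokes on `T³`, at every time `t` and for every
pointwise vorticity bound `M ≥ 0` (`|ω(t,·)|² ≤ M²`),
`d𝒫/dt + ν·D₃ ≤ C·M·𝒫·(1 + log⁺(c·𝒫/(ν·M)))`, `log⁺ y = max 0 (log y)`, stated for every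
one-sided derivative `R` of `s ↦ 𝒫(u s)` within the time interval (majorant form, as
`PalinstrophyLogBudget`). Feeds Osgood (`x' ≤ a(t)·x·log x`) and hence an `H²`-level
Beale–Kato–Majda statement on `T³`. Search for candidate a priori estimates; no regularity claim. -/
@[conjecture] def PalinstrophyLogBudgetKT (C c : ℝ) : Prop :=
  Fintype.card d = 3 → ∀ {ν : ℝ}, 0 < ν → ∀ {a b : ℝ}, a < b →
    ∀ {u : ℝ → UnitAddTorus d → EuclideanSpace ℝ d} {p : ℝ → UnitAddTorus d → ℝ},
      Torus.IsClassicalNSSolutionOn (Icc a b) ν 0 u p →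
      ∀ t ∈ Icc a b, ∀ M : ℝ, 0 ≤ M → (∀ x, torusVorticitySqAt (u t) x ≤ M ^ 2) →
        ∀ R : ℝ, HasDerivWithinAt (fun s => torusPalinstrophy (u s)) R (Icc a b) t →
          R + ν * palinstrophyDissipation (u t) ≤ C * M * torusPalinstrophy (u t) *
            (1 + max 0 (Real.log (c * torusPalinstrophy (u t) / (ν * M))))

/-- (a″) is monotone in the constant `C` (the right-hand side is non-negative termwise). [ours] -/
theorem PalinstrophyLogBudgetKT.mono {C C' c : ℝ} (h : PalinstrophyLogBudgetKT (d := d) C c)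
    (hCC' : C ≤ C') : PalinstrophyLogBudgetKT (d := d) C' c := by
  intro hd ν hν a b hab u p hsol t ht M hM hMx R hR
  refine (h hd hν hab hsol t ht M hM hMx R hR).trans ?_
  have hP : 0 ≤ torusPalinstrophy (u t) := torusPalinstrophy_nonneg _
  have hL : 0 ≤ 1 + max 0 (Real.log (c * torusPalinstrophy (u t) / (ν * M))) :=
    add_nonneg zero_le_one (le_max_left _ _)
  have := mul_le_mul_of_nonneg_right (mul_le_mul_of_nonneg_right hCC' hM) hP
  exact mul_le_mul_of_nonneg_right this hL

/-! ## K1-Q3 is a THRESHOLD law: (a″) forces (a) for every large constant -/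

/-- The explicit constant of `KTImpliesLogBudget`:
`C⋆(C₁, c₁, c) = 2C₁ · (1 + max(0, (log C₁ + 3 log c₁)/2)) · (1 + log⁺(1/c))`. [ours] -/
def palinstrophyLogConst (C₁ c₁ c : ℝ) : ℝ :=
  2 * C₁ * (1 + max 0 ((Real.log C₁ + 3 * Real.log c₁) / 2)) * (1 + max 0 (Real.log (1 / c)))

/-- **Target (prove seat; M-sized real analysis, NO new Literature fact needed): (a″) ⇒ (a) for
every large constant** [ours; sketch, numerically sanity-checked]. If `PalinstrophyLogBudgetKT C₁ c₁`
holds with `C₁, c₁ > 0` then `PalinstrophyLogBudget C c` holds for every `c > 0` with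
`C = palinstrophyLogConst C₁ c₁ c`. Sketch: with `M` the vorticity bound, `𝒫 = torusPalinstrophy`,
`D₃ = palinstrophyDissipation`, the tree's interpolation `𝒫² ≤ (2ℰ)·D₃` (`PalinstrophyInterpolation`,
proved in `PalinstrophyLadderProofs.lean`) and `2ℰ = ‖∇u‖₂² = ‖ω‖₂² ≤ M²` (unit volume, pointwise
bound) give `D₃ ≥ 𝒫²/M²`, so (a″) yields `R ≤ M𝒫·[C₁(1 + log⁺(c₁w)) − w³/X²]` with `w = 𝒫/(νM)`,
`X = 𝒫/ν²` (`w/X = ν/M`). If the bracket is `≤ 0` then `R ≤ 0 ≤ C·M·𝒫·log(e + cX)`. Otherwise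
`w³ < C₁X²(1 + log⁺(c₁w))`, whence (`log(1+t) ≤ t`) `log⁺(c₁w) ≤ max(0, (log C₁ + 3 log c₁)/2) + log⁺X`,
and `1 + K + log⁺X ≤ (1 + K)(1 + log⁺X) ≤ 2(1 + K) log(e + X) ≤ 2(1 + K)(1 + log⁺(1/c)) log(e + cX)`.
Together with the no-go seat's small-constant witnesses (DICTIONARY N10: (a) expected FALSE for
`C < 8/(9π)`) this makes K1-Q3(a) a threshold law with a sharp-constant question, like K1-Q0/K1-Q1 —
conditional only on (a″), i.e. on one Brezis–Gallouët–Wainger fact. Search for candidate a priori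
estimates; no regularity claim. -/
def KTImpliesLogBudget : Prop :=
  ∀ C₁ c₁ : ℝ, 0 < C₁ → 0 < c₁ → PalinstrophyLogBudgetKT (d := d) C₁ c₁ →
    ∀ c : ℝ, 0 < c → PalinstrophyLogBudget (d := d) (palinstrophyLogConst C₁ c₁ c) c

/-- Large-constant truth of the log door (a): for every `c > 0` some `C` works. [ours; conjecture —
follows from `PalinstrophyLogBudgetKT C₁ c₁` and `KTImpliesLogBudget`] -/
@[conjecture] def PalinstrophyLogBudgetLargeC : Prop :=
  ∀ c : ℝ, 0 < c → ∃ C : ℝ, PalinstrophyLogBudget (d := d) C c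

/-- The assembly of the threshold picture's positive half. [ours] -/
theorem palinstrophyLogBudgetLargeC_of_KT {C₁ c₁ : ℝ} (hC₁ : 0 < C₁) (hc₁ : 0 < c₁)
    (hKT : PalinstrophyLogBudgetKT (d := d) C₁ c₁) (himp : KTImpliesLogBudget (d := d)) :
    PalinstrophyLogBudgetLargeC (d := d) := fun c hc =>
  ⟨palinstrophyLogConst C₁ c₁ c, himp C₁ c₁ hC₁ hc₁ hKT c hc⟩

/-! ## (a) is monotone in its constant -/

/-- The log door (a) is monotone in `C` for `c ≥ 0` (its right-hand side is a product of
non-negative factors). Hence "`PalinstrophyLogBudget C c` for all large `C`" and "for some `C`" agree.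
[ours] -/
theorem PalinstrophyLogBudget.mono {C C' c : ℝ} (h : PalinstrophyLogBudget (d := d) C c)
    (hc : 0 ≤ c) (hCC' : C ≤ C') : PalinstrophyLogBudget (d := d) C' c := by
  intro hd ν hν a b hab u p hsol t ht M hM hMx R hR
  refine (h hd hν hab hsol t ht M hM hMx R hR).trans ?_
  have hP : 0 ≤ torusPalinstrophy (u t) := torusPalinstrophy_nonneg _
  have hL : 0 ≤ Real.log (Real.exp 1 + c * torusPalinstrophy (u t) / ν ^ 2) := by
    apply Real.log_nonneg
    have h1 : (1 : ℝ) ≤ Real.exp 1 := by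
      have := Real.add_one_le_exp (1 : ℝ); linarith
    have h2 : 0 ≤ c * torusPalinstrophy (u t) / ν ^ 2 :=
      div_nonneg (mul_nonneg hc hP) (sq_nonneg ν)
    linarith
  have := mul_le_mul_of_nonneg_right (mul_le_mul_of_nonneg_right hCC' hM) hP
  exact mul_le_mul_of_nonneg_right this hL

/-! ## The HELD mediator: Beale–Kato–Majda on the periodic box (Doering–Gibbon 1995, Thm 7.5)

The lit seat is asked to land, as a Literature NAMED FACT with its citation tag, the periodic-box
BKM inequality of Doering–Gibbon, *Applied Analysis of the Navier–Stokes Equations* (CUP 1995),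
Thm 7.5 (7.5.4), p. 125: `‖Du‖_∞ ≤ c‖ω‖_∞[1 + log⁺(Lκ_{N,r})] + L^{-3/2}‖ω‖₂` for `N ≥ 3`,
`0 ≤ r < N`, `κ_{N,r} = (F_N/F_r)^{1/(2(N−r))}` (p. 104), `F_N = H_N = ∫|D^N u|²` at zero forcing
((6.1.10)). The SHAPE below (`BKMLogGradientBound c`, case `N = 3`, `r = 2`, `L = 1`, with
`½ log⁺(D₃/𝒫)` and `‖ω‖₂ ≤ M` absorbed into `c`) is what this file consumes; it is stated in the
tree's majorant vocabulary (`PalinstrophyProductionSupBound`, `GradientAgmonBound`). NOTHING is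
asserted: `BKMLogGradientBound c` is a `Prop`, used below only as a hypothesis. [shape ours; the
inequality is DG95 Thm 7.5 / BKM 1984 — to be cited by the lit seat, not here] -/

/-- Shape of the periodic-box BKM fact (DG95 Thm 7.5 with `N = 3`, `r = 2`, unit box, zero forcing),
majorant form: for smooth divergence-free `v` on `T³` and every pointwise vorticity bound `M ≥ 0`,
`Σᵢ‖∂ᵢv(x)‖² ≤ (c·M·(1 + log⁺(D₃(v)/𝒫(v))))²` at every `x`. A hypothesis here, never asserted.
Search for candidate a priori estimates; no regularity claim. -/
def BKMLogGradientBound (c : ℝ) : Prop :=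
  Fintype.card d = 3 → ∀ v : UnitAddTorus d → EuclideanSpace ℝ d, Torus.IsSmooth v →
    Torus.IsDivFree v → ∀ M : ℝ, 0 ≤ M → (∀ x, torusVorticitySqAt v x ≤ M ^ 2) →
      ∀ x, ∑ i, ‖Torus.partialDeriv i v x‖ ^ 2 ≤
        (c * M * (1 + max 0 (Real.log (palinstrophyDissipation v / torusPalinstrophy v)))) ^ 2

/-- **K1-Q3(a‴) — the Doering–Gibbon-mediated log door** [ours; conjecture as typed, expected
provable from `BKMLogGradientBound` + `PalinstrophyProductionSupBound`]: along classical solutions,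
`d𝒫/dt + ν·D₃ ≤ C·M·𝒫·(1 + log⁺(c·M/ν))` for every pointwise vorticity bound `M` (majorant form).
Its log argument `M/ν` (a vorticity Reynolds number) is neither above nor below (a″)'s `𝒫/(νM)` in
general. Search for candidate a priori estimates; no regularity claim. -/
@[conjecture] def PalinstrophyLogBudgetDG (C c : ℝ) : Prop :=
  Fintype.card d = 3 → ∀ {ν : ℝ}, 0 < ν → ∀ {a b : ℝ}, a < b →
    ∀ {u : ℝ → UnitAddTorus d → EuclideanSpace ℝ d} {p : ℝ → UnitAddTorus d → ℝ},
      Torus.IsClassicalNSSolutionOn (Icc a b) ν 0 u p →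
      ∀ t ∈ Icc a b, ∀ M : ℝ, 0 ≤ M → (∀ x, torusVorticitySqAt (u t) x ≤ M ^ 2) →
        ∀ R : ℝ, HasDerivWithinAt (fun s => torusPalinstrophy (u s)) R (Icc a b) t →
          R + ν * palinstrophyDissipation (u t) ≤ C * M * torusPalinstrophy (u t) *
            (1 + max 0 (Real.log (c * M / ν)))

/-- (a‴) is monotone in the constant `C`. [ours] -/
theorem PalinstrophyLogBudgetDG.mono {C C' c : ℝ} (h : PalinstrophyLogBudgetDG (d := d) C c)
    (hCC' : C ≤ C') : PalinstrophyLogBudgetDG (d := d) C' c := by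
  intro hd ν hν a b hab u p hsol t ht M hM hMx R hR
  refine (h hd hν hab hsol t ht M hM hMx R hR).trans ?_
  have hP : 0 ≤ torusPalinstrophy (u t) := torusPalinstrophy_nonneg _
  have hL : 0 ≤ 1 + max 0 (Real.log (c * M / ν)) := add_nonneg zero_le_one (le_max_left _ _)
  have := mul_le_mul_of_nonneg_right (mul_le_mul_of_nonneg_right hCC' hM) hP
  exact mul_le_mul_of_nonneg_right this hL

/-- **Target (prove seat; S-sized once the fact is a hypothesis): BKM ⇒ (a‴)** with the explicit
constants `C = c′ = 6c`: by the `𝒫` balance `R = 2N − 2νD₃` (`torusPalinstrophy_hasDerivWithinAt`,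
derivative unique within `Icc a b`), `N ≤ 3·G·𝒫` for the gradient majorant
`G = cM(1 + log⁺(D₃/𝒫))` (`PalinstrophyProductionSupBound`, in the tree), and the real inequality
`sup_{D > 0} [A·log⁺(D/𝒫) − νD] ≤ A·log⁺(A/(ν𝒫))` with `A = 6cM𝒫`:
`R + νD₃ ≤ 6cM𝒫 + 6cM𝒫·log⁺(6cM/ν)`. Search for candidate a priori estimates; no regularity claim. -/
def BKMImpliesDG : Prop :=
  ∀ c : ℝ, 0 < c → BKMLogGradientBound (d := d) c → PalinstrophyLogBudgetDG (d := d) (6 * c) (6 * c)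

/-- **Target (prove seat; M-sized real analysis on tree material, NO new fact): (a‴) ⇒ (a) for all
large constants** [ours; sketch]. Given `PalinstrophyLogBudgetDG C₁ c₁` (`C₁, c₁ > 0`) and `c > 0`
there is `C₀` with `PalinstrophyLogBudget C c` for every `C ≥ C₀`. Sketch: fix a state and an
admissible `M`; if `R ≤ 0` there is nothing to show. If `R > 0` then (balance + uniqueness of the
derivative) `νD₃ < N ≤ 3G𝒫` with the tree's Agmon majorant `G² = (2/π²)√(𝒫D₃)`
(`GradientAgmonBound`), whence `D₃^{3/4} < 3(2/π²)^{1/2}𝒫^{5/4}/ν`, and the ADMISSIBLE bound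
`M₁ := √2·G` (pointwise `|ω|² ≤ 2Σᵢ‖∂ᵢu‖²`) satisfies `M₁/ν ≤ c′·(𝒫/ν²)^{2/3}`. Apply (a‴) at
`min(M, M₁)`-style: if `M ≥ M₁` use (a‴) at `M₁` and `M₁ ≤ M`; if `M < M₁` use (a‴) at `M` and
`log⁺(c₁M/ν) ≤ log⁺(c₁M₁/ν)`; either way `R ≤ C₁M𝒫(1 + log⁺(c₁c′X^{2/3}))`, `X = 𝒫/ν²`, and
`1 + log⁺(c₁c′X^{2/3}) ≤ K·(1 + log⁺(1/c))·log(e + cX)` for an explicit `K(C₁, c₁, c′)`. With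
`PalinstrophyLogBudget.mono` this is "for all `C ≥ C₀`". Search for candidate a priori estimates; no
regularity claim. -/
def DGImpliesLogBudget : Prop :=
  ∀ C₁ c₁ : ℝ, 0 < C₁ → 0 < c₁ → PalinstrophyLogBudgetDG (d := d) C₁ c₁ →
    ∀ c : ℝ, 0 < c → ∃ C₀ : ℝ, ∀ C : ℝ, C₀ ≤ C → PalinstrophyLogBudget (d := d) C c

/-- The assembly of the HELD-fact chain: BKM (DG95 Thm 7.5 shape) ⇒ (a‴) ⇒ (a) for all large `C`.
[ours] -/
theorem palinstrophyLogBudgetLargeC_of_BKM {c : ℝ} (hc : 0 < c)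
    (hBKM : BKMLogGradientBound (d := d) c) (h₁ : BKMImpliesDG (d := d))
    (h₂ : DGImpliesLogBudget (d := d)) : PalinstrophyLogBudgetLargeC (d := d) := by
  intro c' hc'
  have h6 : (0 : ℝ) < 6 * c := by positivity
  obtain ⟨C₀, hC₀⟩ := h₂ (6 * c) (6 * c) h6 h6 (h₁ c hc hBKM) c' hc'
  exact ⟨C₀, hC₀ C₀ le_rfl⟩


/-! ## v6: the landed periodic-box BKM fact IS the hypothesis at `d = Fin 3`

`Literature.Analysis.FunctionSpaces.Torus.exists_gradSq_le_sq_bkm_posLog_ratio` (lit seat, p201667;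
DG95 Thm 7.5, eq. (7.5.4), `N = 3`, `r = 2`, unit torus, mean subtracted inside the Literature proof):
`∃ c > 0, ∀ v` smooth divergence-free, `∀ M ≥ 0` with `|ω|² ≤ M²`, `∀ x`,
`∑ᵢ‖∂ᵢv(x)‖² ≤ (c M (1 + log⁺(H₃/H₂)))²` with `H₃ = gradNormSq (Δv) = D₃`, `H₂ = ∫‖Δv‖² = 𝒫` —
literally `BKMLogGradientBound (d := Fin 3) c` after `Fintype.card (Fin 3) = 3` is discarded
(`palinstrophyDissipation`, `torusPalinstrophy` unfold to `H₃`, `H₂` by `rfl`).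
Search for candidate a priori estimates; no regularity claim. -/

/-- **The BKM hypothesis is a THEOREM at `d = Fin 3`** (from the Literature fact p201667). [ours;
the inequality is Doering–Gibbon 1995 Thm 7.5 / Beale–Kato–Majda 1984 on the periodic box] -/
theorem exists_bkmLogGradientBound_fin3 : ∃ c : ℝ, 0 < c ∧ BKMLogGradientBound (d := Fin 3) c := by
  obtain ⟨c, hc, h⟩ := Torus.exists_gradSq_le_sq_bkm_posLog_ratio
  exact ⟨c, hc, fun _ v hv hdiv M hM hMx x => h v hv hdiv M hM hMx x⟩

/-- **Assembly at `d = Fin 3` with NO pending fact** [ours]: BKM ⇒ (a‴) (target `BKMImpliesDG`, S)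
and (a‴) ⇒ (a) for large `C` (target `DGImpliesLogBudget`, M) give `PalinstrophyLogBudgetLargeC`:
the typed log door K1-Q3(a) holds on `T³` for every `c > 0` and all sufficiently large `C` — the
positive half of the threshold law (negative half: `PalinstrophyLogThreshold`, no-go seat, `C < 2/π`).
Search for candidate a priori estimates; no regularity claim. -/
theorem palinstrophyLogBudgetLargeC_fin3 (h₁ : BKMImpliesDG (d := Fin 3))
    (h₂ : DGImpliesLogBudget (d := Fin 3)) : PalinstrophyLogBudgetLargeC (d := Fin 3) := by
  obtain ⟨c, hc, hBKM⟩ := exists_bkmLogGradientBound_fin3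
  exact palinstrophyLogBudgetLargeC_of_BKM hc hBKM h₁ h₂


/-! ## v6: `BKMImpliesDG` PROVED (BKM ⇒ (a‴) with constants `6c`, `6c`)

From the `𝒫` balance (`torusPalinstrophy_hasDerivWithinAt`, derivative unique within `Icc a b`),
the tree theorem `palinstrophyProductionSupBound_holds` (`N ≤ 3G𝒫` for a pointwise gradient majorant
`G`), the BKM majorant `G = cM(1 + log⁺(D₃/𝒫))`, and the real absorption
`K𝒫·log⁺(D/𝒫) − νD ≤ K𝒫·log⁺(K/ν)` (`log z ≤ z − 1`). Search for candidate a priori estimates; no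
regularity claim. -/

/-- Real absorption step: `K·P·log⁺(D/P) − ν·D ≤ K·P·log⁺(K/ν)` for `K, P, D ≥ 0`, `ν > 0`
(`log⁺ = max 0 ∘ log`; Lean's junk conventions `x/0 = 0`, `log 0 = 0` included). [ours; elementary] -/
theorem mul_posLog_div_sub_le (K P D ν : ℝ) (hK : 0 ≤ K) (hP : 0 ≤ P) (hD : 0 ≤ D) (hν : 0 < ν) :
    K * P * max 0 (Real.log (D / P)) - ν * D ≤ K * P * max 0 (Real.log (K / ν)) := by
  have hKP : 0 ≤ K * P := mul_nonneg hK hP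
  have hνD : 0 ≤ ν * D := mul_nonneg hν.le hD
  have hR0 : 0 ≤ K * P * max 0 (Real.log (K / ν)) := mul_nonneg hKP (le_max_left _ _)
  rcases le_or_gt (Real.log (D / P)) 0 with hle | hlt
  · rw [max_eq_left hle, mul_zero, zero_sub]
    linarith
  · rw [max_eq_right hlt.le]
    have hDP : 1 < D / P := by
      rcases le_or_gt (D / P) 1 with h | h
      · exact absurd (Real.log_nonpos (div_nonneg hD hP) h) (not_le.mpr hlt)
      · exact h
    have hPpos : 0 < P := by
      rcases hP.eq_or_lt with h0 | h0
      · rw [← h0, div_zero] at hDP; linarith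
      · exact h0
    have hDpos : 0 < D := by
      rcases hD.eq_or_lt with h0 | h0
      · rw [← h0, zero_div] at hDP; linarith
      · exact h0
    rcases hK.eq_or_lt with hK0 | hKpos
    · have h1 : K * P = 0 := by rw [← hK0, zero_mul]
      rw [h1, zero_mul, zero_mul, zero_sub]
      linarith
    · have hKP' : 0 < K * P := mul_pos hKpos hPpos
      have hPne : P ≠ 0 := hPpos.ne'
      have hKne : K ≠ 0 := hKpos.ne'
      have hνne : ν ≠ 0 := hν.ne'
      have hDne : D ≠ 0 := hDpos.ne'
      have hsplit : Real.log (D / P) = Real.log (ν * D / (K * P)) + Real.log (K / ν) := by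
        rw [← Real.log_mul (by positivity) (by positivity)]
        congr 1
        field_simp
      have hlog_le : Real.log (ν * D / (K * P)) ≤ ν * D / (K * P) - 1 :=
        Real.log_le_sub_one_of_pos (by positivity)
      have hprod : K * P * (ν * D / (K * P) - 1) = ν * D - K * P := by
        field_simp
      have hmain : K * P * Real.log (D / P) ≤ ν * D - K * P + K * P * Real.log (K / ν) := by
        rw [hsplit, mul_add]
        have := mul_le_mul_of_nonneg_left hlog_le hKP'.le
        linarith [this, hprod.le, hprod.ge]
      have hlogmax : K * P * Real.log (K / ν) ≤ K * P * max 0 (Real.log (K / ν)) :=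
        mul_le_mul_of_nonneg_left (le_max_right _ _) hKP
      linarith

/-- **`BKMImpliesDG` holds** (v6; was an S-sized prove target in v3–v5): BKM ⇒ (a‴) with
`C = c′ = 6c`, in every admissible dimension type (the content is at `Fintype.card d = 3`).
[ours; ingredients: tree theorems `torusPalinstrophy_hasDerivWithinAt`,
`palinstrophyProductionSupBound_holds`, and `mul_posLog_div_sub_le`] -/
theorem bkmImpliesDG_holds : BKMImpliesDG (d := d) := by
  intro c hc hBKM hd ν hν a b hab u p hsol t ht M hM hMx R hR
  have hder := torusPalinstrophy_hasDerivWithinAt hsol hab ht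
  have hU := uniqueDiffOn_Icc hab t ht
  have hRval : R = 2 * palinstrophyProduction (u t) - 2 * ν * palinstrophyDissipation (u t) :=
    (hR.derivWithin hU).symm.trans (hder.derivWithin hU)
  have hsm : Torus.IsSmooth (u t) := hsol.smooth_velocity.isSmooth_slice ht
  have hdf : Torus.IsDivFree (u t) := hsol.divFree t ht
  have hP0 : 0 ≤ torusPalinstrophy (u t) := torusPalinstrophy_nonneg _
  have hD0 : 0 ≤ palinstrophyDissipation (u t) := palinstrophyDissipation_nonneg _
  have hL0 : 0 ≤ max 0 (Real.log (palinstrophyDissipation (u t) / torusPalinstrophy (u t))) :=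
    le_max_left _ _
  -- the BKM gradient majorant `G = c M (1 + L)`
  have hG0 : 0 ≤ c * M * (1 + max 0 (Real.log (palinstrophyDissipation (u t) /
      torusPalinstrophy (u t)))) := by positivity
  have hgrad : ∀ x, ∑ i, ‖Torus.partialDeriv i (u t) x‖ ^ 2 ≤ (c * M * (1 + max 0 (Real.log
      (palinstrophyDissipation (u t) / torusPalinstrophy (u t))))) ^ 2 :=
    fun x => hBKM hd (u t) hsm hdf M hM hMx x
  -- production bound (tree theorem L1): `N ≤ 3 G 𝒫`
  have hN : palinstrophyProduction (u t) ≤ 3 * (c * M * (1 + max 0 (Real.log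
      (palinstrophyDissipation (u t) / torusPalinstrophy (u t))))) * torusPalinstrophy (u t) :=
    palinstrophyProductionSupBound_holds hd (u t) hsm hdf _ hG0 hgrad
  -- real absorption with `K = 6 c M`
  have key := mul_posLog_div_sub_le (6 * c * M) (torusPalinstrophy (u t))
    (palinstrophyDissipation (u t)) ν (by positivity) hP0 hD0 hν
  rw [hRval]
  have hνD : 0 ≤ ν * palinstrophyDissipation (u t) := mul_nonneg hν.le hD0
  nlinarith [hN, key, hνD, mul_nonneg (mul_nonneg (by positivity : (0:ℝ) ≤ 6 * c * M) hP0) hL0]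

/-- **With `BKMImpliesDG` proved, the large-`C` door at `d = Fin 3` is ONE target away** [ours]:
`DGImpliesLogBudget (d := Fin 3) → PalinstrophyLogBudgetLargeC (d := Fin 3)`.
Search for candidate a priori estimates; no regularity claim. -/
theorem palinstrophyLogBudgetLargeC_fin3_of_DG (h₂ : DGImpliesLogBudget (d := Fin 3)) :
    PalinstrophyLogBudgetLargeC (d := Fin 3) :=
  palinstrophyLogBudgetLargeC_fin3 bkmImpliesDG_holds h₂

end Summit.NavierStokesRegularity.FunctionalMining
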